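import Literature.Analysis.FluidPDE.CKNPressureHessianSlice
import Literature.Analysis.FunctionSpaces.SobolevTraceDensityHigherProofs
import Literature.Analysis.FunctionSpaces.SobolevDomainNormProofs
import Mathlib.Analysis.Calculus.BumpFunction.FiniteDimension
import HarnessLib

/-!
# `W^{k,p}(Ω)` is stable under continuous linear maps of the values and under multiplication by
# smooth functions (bounded `Ω`)

Analysis/FunctionSpaces theorem file (no definitions, no named facts) completing the algebra of the
tree's Sobolev classes `MemSobolevDomain k p Ω μ` (`SobolevDomain.lean`) at every order `k`:

* `MemSobolevDomain.clm_apply`: `x ↦ L (f x) ∈ W^{k,p}(Ω)` for `f ∈ W^{k,p}(Ω; F)` and a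
  continuous linear `L : F →L[ℝ] F'` (induction on `k`, with the tree's `HasWeakFDerivOn.clm_comp`);
  hence the components `⟪c, f⟫` of a vector-valued Sobolev function (`const_inner`) and
  `x ↦ f x • c` for a scalar one (`smul_const`) are Sobolev of the same order;
* `MemSobolevDomain.smooth_smul` / `smooth_mul`: on a bounded `Ω`, multiplication by ANY smooth
  function preserves `W^{k,p}(Ω)` (the tree's `memSobolevDomain_smul` asks for compact support;
  cut the multiplier off outside `Ω̄` with a bump and use `memSobolevDomain_congr`);
* `fun`-form wrappers for sums (`memSobolevDomain_finsetSum`, `add'`, `sub'`).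

Used by the boundary regularity of the Neumann problem at every Sobolev order
(`Analysis/PDE/NeumannHalfBallNormal.lean`, `NeumannHalfBallHigher.lean`).

## References

* H. Brezis, *Functional Analysis, Sobolev Spaces and PDE* (2011), §9.1, Proposition 9.4
  (products) and p. 271 (linearity). [Brezis2011]
* R. A. Adams, *Sobolev Spaces* (1975), ¶1.58, ¶3.1. [Adams1975]
-/

noncomputable section

open MeasureTheory TopologicalSpace Set Function Filter Topology Metric
open scoped ENNReal NNReal RealInnerProductSpace ContDiff

namespace Literature.Analysis.FunctionSpaces

open SobolevApprox

variable {E' : Type*} [NormedAddCommGroup E'] [NormedSpace ℝ E'] [MeasurableSpace E']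
  [BorelSpace E'] [FiniteDimensional ℝ E']
variable {F : Type*} [NormedAddCommGroup F] [NormedSpace ℝ F] [CompleteSpace F]
variable {F' : Type*} [NormedAddCommGroup F'] [NormedSpace ℝ F'] [CompleteSpace F']
variable {Ω : Opens E'} {μ : Measure E'} {p : ℝ≥0∞}

omit [FiniteDimensional ℝ E'] in
/-- **`W^{k,p}(Ω)` is stable under continuous linear maps of the values**: `x ↦ L(f x)` lies in
`W^{k,p}(Ω; F')` for `f ∈ W^{k,p}(Ω; F)`, with weak derivatives `L ∘ D^α f` (Brezis, §9.1,
p. 271; induction on `k` with `HasWeakFDerivOn.clm_comp`). [cite: Brezis2011, §9.1 p. 271] -/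
theorem MemSobolevDomain.clm_apply {k : ℕ} :
    ∀ {f : E' → F}, MemSobolevDomain k p Ω μ f → ∀ L : F →L[ℝ] F',
      MemSobolevDomain k p Ω μ (fun x => L (f x)) := by
  induction k with
  | zero =>
    intro f hf L
    rw [memSobolevDomain_zero_iff] at hf ⊢
    exact L.comp_memLp' hf
  | succ k ih =>
    intro f hf L
    obtain ⟨h0, g, hg, hgk⟩ := hf
    exact ⟨L.comp_memLp' h0, _, hg.clm_comp L, fun v => ih (hgk v) L⟩

omit [FiniteDimensional ℝ E'] in
/-- The components `⟪c, f⟫` of a vector-valued `W^{k,p}(Ω)` function are in `W^{k,p}(Ω)`.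
[folklore] -/
theorem MemSobolevDomain.const_inner {H : Type*} [NormedAddCommGroup H] [InnerProductSpace ℝ H]
    [CompleteSpace H] {k : ℕ} {f : E' → H} (hf : MemSobolevDomain k p Ω μ f) (c : H) :
    MemSobolevDomain k p Ω μ (fun x => ⟪c, f x⟫) := by
  have := hf.clm_apply (innerSL ℝ c)
  simpa only [innerSL_apply_apply] using this

omit [FiniteDimensional ℝ E'] in
omit [FiniteDimensional ℝ E'] in
/-- A scalar `W^{k,p}(Ω)` function times a constant vector is in `W^{k,p}(Ω; F)`. [folklore] -/
theorem MemSobolevDomain.smul_const {k : ℕ} {f : E' → ℝ} (hf : MemSobolevDomain k p Ω μ f)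
    (c : F) : MemSobolevDomain k p Ω μ (fun x => f x • c) := by
  have := hf.clm_apply (ContinuousLinearMap.toSpanSingleton ℝ c)
  simpa only [ContinuousLinearMap.toSpanSingleton_apply] using this

omit [CompleteSpace F] in
/-- **Multiplication by a smooth function preserves `W^{k,p}(Ω)` on a bounded `Ω`** (Brezis,
§9.1, Proposition 9.4 / Evans §5.2.3 Theorem 1 (iv); the tree's `memSobolevDomain_smul` for
compactly supported multipliers, applied to the multiplier cut off outside `Ω̄`).
[cite: Brezis2011, §9.1 Proposition 9.4] -/
theorem MemSobolevDomain.smooth_smul {k : ℕ} {f : E' → F} (hf : MemSobolevDomain k p Ω μ f)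
    (hb : Bornology.IsBounded (Ω : Set E')) {ψ : E' → ℝ} (hψ : ContDiff ℝ ∞ ψ) :
    MemSobolevDomain k p Ω μ (fun x => ψ x • f x) := by
  obtain ⟨R, hR⟩ := hb.subset_closedBall (0 : E')
  let χ : ContDiffBump (0 : E') := ⟨max R 0 + 1, max R 0 + 2, by positivity, by linarith⟩
  have hχ1 : ∀ x ∈ (Ω : Set E'), (χ : E' → ℝ) x = 1 := fun x hx =>
    χ.one_of_mem_closedBall (by
      have := hR hx
      rw [mem_closedBall] at this ⊢
      show dist x 0 ≤ max R 0 + 1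
      linarith [le_max_left R 0])
  have h := memSobolevDomain_smul hf (hψ.mul χ.contDiff) (χ.hasCompactSupport.mul_left)
  exact memSobolevDomain_congr h fun x hx => by
    show ψ x • f x = (ψ x * χ x) • f x
    rw [hχ1 x hx, mul_one]

/-- Multiplication by a smooth real function preserves scalar `W^{k,p}(Ω)` on a bounded `Ω`.
[cite: Brezis2011, §9.1 Proposition 9.4] -/
theorem MemSobolevDomain.smooth_mul {k : ℕ} {f : E' → ℝ} (hf : MemSobolevDomain k p Ω μ f)
    (hb : Bornology.IsBounded (Ω : Set E')) {ψ : E' → ℝ} (hψ : ContDiff ℝ ∞ ψ) :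
    MemSobolevDomain k p Ω μ (fun x => ψ x * f x) :=
  hf.smooth_smul hb hψ

omit [BorelSpace E'] [FiniteDimensional ℝ E'] [CompleteSpace F] in
/-- `W^{k,p}(Ω)` is closed under addition (`fun`-form of `memSobolevDomain_add`). [folklore] -/
theorem MemSobolevDomain.add' [OpensMeasurableSpace E'] {k : ℕ} {f g : E' → F}
    (hf : MemSobolevDomain k p Ω μ f) (hg : MemSobolevDomain k p Ω μ g) :
    MemSobolevDomain k p Ω μ (fun x => f x + g x) :=
  memSobolevDomain_add hf hg

omit [BorelSpace E'] [FiniteDimensional ℝ E'] [CompleteSpace F] in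
/-- `W^{k,p}(Ω)` is closed under subtraction (`fun`-form of `memSobolevDomain_sub`). [folklore] -/
theorem MemSobolevDomain.sub' [OpensMeasurableSpace E'] {k : ℕ} {f g : E' → F}
    (hf : MemSobolevDomain k p Ω μ f) (hg : MemSobolevDomain k p Ω μ g) :
    MemSobolevDomain k p Ω μ (fun x => f x - g x) :=
  memSobolevDomain_sub hf hg

omit [BorelSpace E'] [FiniteDimensional ℝ E'] [CompleteSpace F] in
/-- `W^{k,p}(Ω)` is closed under finite sums (`fun`-form of `MemSobolevDomain.sum`). [folklore] -/
theorem memSobolevDomain_finsetSum [OpensMeasurableSpace E'] {ι : Type*} {k : ℕ} (s : Finset ι)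
    {u : ι → E' → F} (h : ∀ i ∈ s, MemSobolevDomain k p Ω μ (u i)) :
    MemSobolevDomain k p Ω μ (fun x => ∑ i ∈ s, u i x) := by
  have := MemSobolevDomain.sum (s := s) h
  have e : (fun x => ∑ i ∈ s, u i x) = ∑ i ∈ s, u i := by
    funext x; exact (Finset.sum_apply x s u).symm
  rw [e]; exact this

omit [BorelSpace E'] [FiniteDimensional ℝ E'] [CompleteSpace F] in
/-- `W^{k,p}(Ω)` is closed under multiplication by constants (`fun`-form). [folklore] -/
theorem MemSobolevDomain.const_mul' {k : ℕ} {f : E' → ℝ} (hf : MemSobolevDomain k p Ω μ f)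
    (c : ℝ) : MemSobolevDomain k p Ω μ (fun x => c * f x) :=
  hf.const_smul c

end Literature.Analysis.FunctionSpaces

end
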